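/-
Copyright (c) 2026 the pub-hodgecm-mathlib formalisation cell (harness21).  Prover seat hodgecm-mathlib-LH4-p13 (g0): Track A «(D-RAM) FOUR-FRAME» squad of crux H413
(21-frontier RULING «PUSH BOTH» 2026-09-03T19:47:09Z; heir LEAD F0P3a-plan (g19) l.72403 + amendment; dealer LH4-plan (g10) WORD #26 «T3 → LH4-p02 (+p13 helper)»;
split interface LH4-p02 (g12) 21:21:58Z), 2026-09-03.
-/
import Summits.HodgeConjecture.HodgeConjecture.Theorems.F0P3cDyRamTableDiagWitnessTransvMinus   -- ★ p854895 (LH4-p02 (g12)): `cornerUnipotent_sub_one`, `xPlus_eq` (the `ℓ = 2` sister; brings ★ T1 `F0P3cDyRamUnipotentLabelInjOn`, ★ №3∕№6, ★ `F0P3cDyRamDOfPlaceOfDatum`, ★ `F0P3cDyRamWildPlaceDatum`)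
import Summits.HodgeConjecture.HodgeConjecture.Theorems.F0P3cDyRamShellLabelPlus               -- ★ (LH4-p03 (g11)): `pairing_xPlus_mulVec`; brings ★ `F0P3cDyRamPiecesShellLemmas` (`nearTransvShell_xPlus`, `labelPlus_xPlus`, `xPlus_mul_xPlus`), ★ `WildQuadraticDatumRefSkewScalar`
import Summits.HodgeConjecture.HodgeConjecture.Theorems.F0P3cDyRamPiecePropsUnit0              -- ★ p854783 (F0P3-p01 (g30)): `mem_cmLocalIntegralLevel_of_inLevel` (the level-`M` congruence set lies in `K`)
import HarnessLib

/-!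
# Crux `H413`, line LH4 «(D-RAM) FOUR-FRAME», tier 2 under `U4_Rows` §2 (iv-a)·T3: THE CLASS-`+` DIAGONAL WITNESS — every class-`+` unitary transvection class MEETS
# the support of `f_{T+}` inside `K`

Cell `hodgecm-mathlib` (D-0151), FLOOR 0, crux item H413 = `stmt-HodgeConjecture-24833`, route of record `HCCMUnconditional`; squad F0∕P3c∕LH4, Track A; dealer LH4-plan
(g10) WORD #26; tier-1 module ★ `Cruxes/H413/Lines/F0_P3c_DyRamFourFrame_U4_Rows.lean` ED. 3 §2, row T3 `stub_U4_table_diag_ne_zero` (payer: LH4-p02 (g12),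
`Theorems/F0P3cDyRamTableDiagNeZero.lean`; THIS FILE is the `ℓ = 1` witness of its split — LH4-p02 21:25:02Z «split = YES, asymmetric: p13 → the T₊ WITNESS ONLY», head and
set named there; sister files ★ p854880 `F0P3cDyRamTableDiagWitnessReg` (`ℓ = 3`), ★ p854895 `F0P3cDyRamTableDiagWitnessTransvMinus` (`ℓ = 2`)).  THEOREMS ONLY (no `def`,
no instance, no notation, no `sorry`, default heartbeats); lane `--supports stmt-HodgeConjecture-24833 --as helper`.

THE MATHEMATICS ([Rogawski1990] §3.9, §4.9).  `K = L_w` at a ramified `σ`-stable place, `σ = σ_w`, `Φ₃` antidiagonal, `ψ = localNonsplitEquiv`, `X := wMatrix u − 1`;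
`t₊ := (ϖ − σϖ)·((ϖσϖ)^{⌊d∕2⌋})⁻¹` the coefficient of ★ `xPlus` (skew ★ `map_refSkewScalar_eq_neg`, `|t₊| = exp(−ℓ₀) ≤ 1` ★ `v_refSkewScalar`, `ℓ₀ = d % 2`), `n(t) = 1 + t·E₀₂`.
The corner unipotent `x₊ := ψ⁻¹ n(t₊)` lies in `K` (`n(t₊) ∈ U(σ_w, Φ₃)` ★ `mem_unitaryGroupOfForm_iff_of_coe_eq_cornerUnipotent`; integral entries ⇒ ★
`mem_cmLocalIntegralLevel_of_inLevel` at `M = 0`); `wMatrix x₊ − 1 = xPlus σ ϖ dOfPlace` (★ `cornerUnipotent_sub_one`, ★ `xPlus_eq`; `dOfPlace = d` ★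
`dOfPlace_eq_of_isRamifiedQuadraticDatum`) is on the shell `NearTransvShell ϖ ℓ₀ m*` (★ `nearTransvShell_xPlus`) and carries `LabelPlus` BY DEFINITION (★ `labelPlus_xPlus`,
`rfl`); it is a class-`+` transvection (`xPlus ≠ 0`, `xPlus² = 0` ★ `xPlus_mul_xPlus`, `NormClassPlus` with the value `t₊ = ⟨e₂, xPlus·e₂⟩` ★ `pairing_xPlus_mulVec`), so every
class-`+` transvection class is ITS class (★ T1 `isConj_of_normClassPlus`: the classes of the `n(t)` are the norm classes `t·N(L_w^×)`).  No conductor input on this side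
(the `ℓ = 2` sister needs Serre V §3; this one does not).

* §1 `cornerUnipotent_sub_one_apply` (entries of `t·E₀₂`), **`exists_mem_wMatrix_eq_cornerUnipotent`** (corner unipotents `ψ⁻¹ n(t) ∈ K` for skew integral `t`).
* §2 **`exists_mem_supportTransvPlus_mk_eq`** — LH4-p02's interface head, set = the literal set-builder of ★ `pieceTransvPlus` (by-import tie `Set.indicator_of_mem` ∕ `rfl`
  GREEN in HOME `TieProbe`).

HONEST LABEL.  Count-neutral helper (`--supports 24833`; no stub paid here — the payer of `stub_U4_table_diag_ne_zero` is LH4-p02's head file, which `exact`s this head).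
(D-RAM) verdict of record PRINT [LanglandsShelstad1989 Thm. p. 484 ∕ Rogawski1990 Prop. 4.9.1 (a)] ∕ XL; `HC_CM` is proved only modulo the 7 printed citations (2 remaining:
hLiu418 = `stmt-HodgeConjecture-24832`, h413 = `stmt-HodgeConjecture-24833`) until rung 0 closes.

## References
* [Rogawski1990] J. D. Rogawski, *Automorphic Representations of Unitary Groups in Three Variables*, Ann. of Math. Stud. 123 (1990), §1.10 p. 9, §3.9 p. 32, §4.9 pp. 54–55.
* [LabesseLanglands1979] J.-P. Labesse, R. P. Langlands, *L-indistinguishability for SL(2)*, Canad. J. Math. 31 (1979), §2 (norm classes `F^×∕N(E^×)`).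
-/

noncomputable section

namespace Summit.HodgeConjecture.HodgeConjecture.Cruxes.H413.F0P3cDyRamTableDiagWitnessTransvPlus

open NumberField IsDedekindDomain
open Literature.NumberTheory.Automorphic Literature.NumberTheory.Automorphic.UnitaryGroup
open Literature.NumberTheory.Automorphic.UnitaryLatticeTree Literature.NumberTheory.Automorphic.HermitianLattice
open Literature.NumberTheory.Automorphic.UnitaryThreeFourFrame
open Literature.NumberTheory.Rogawski1990 Literature.NumberTheory.GaloisRepresentations
open Literature.NumberTheory.LocalFields.WildQuadraticDatum
open Summit.HodgeConjecture.HodgeConjecture.Cruxes.H413.F0P3cDyRamFourFramePieces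
open Summit.HodgeConjecture.HodgeConjecture.Cruxes.H413.F0P3cDyRamFourFrameUnipotentLabelDefs
open Summit.HodgeConjecture.HodgeConjecture.Cruxes.H413.F0P3cDyRamPiecesShellLemmas
open Summit.HodgeConjecture.HodgeConjecture.Cruxes.H413.F0P3cDyRamUnipotentLabelInjOn
open Summit.HodgeConjecture.HodgeConjecture.Cruxes.H413.F0P3cDyRamShellLabelPlus (pairing_xPlus_mulVec)
open Summit.HodgeConjecture.HodgeConjecture.Cruxes.H413.F0P3cDyRamTableDiagWitnessTransvMinus (cornerUnipotent_sub_one xPlus_eq)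
open Summit.HodgeConjecture.HodgeConjecture.Cruxes.H413.F0P3cDyRamWildPlaceDatum (exists_isRamifiedQuadraticDatum_of_placesOver)
open Summit.HodgeConjecture.HodgeConjecture.Cruxes.H413.F0P3cDyRamDOfPlaceOfDatum (dOfPlace_eq_of_isRamifiedQuadraticDatum)
open Summit.HodgeConjecture.HodgeConjecture.Cruxes.H413.F0P3cDyRamPiecePropsUnit0 (mem_cmLocalIntegralLevel_of_inLevel)
open Summit.HodgeConjecture.HodgeConjecture.Cruxes.H413.F0P3cDyRamProfilePiecesProps (uniformizer_facts)
open scoped Matrix MatrixGroups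
open WithZero

/-! ## §1  Corner unipotents `n(t) = 1 + t·E₀₂` of `K` -/

section Field

variable {K : Type*} [Field K]

/-- The entries of `n(t) − 1 = t·E₀₂`: `t` at `(0,2)`, zero elsewhere. [cite: Rogawski1990, §1.10 p. 9] -/
theorem cornerUnipotent_sub_one_apply (t : K) (i j : Fin 3) :
    ((!![1, 0, t; 0, 1, 0; 0, 0, 1] : Matrix (Fin 3) (Fin 3) K) - 1) i j = if i = 0 ∧ j = 2 then t else 0 := by
  fin_cases i <;> fin_cases j <;> simp

end Field

section CM

variable (L : Type) [Field L] [NumberField L] [IsCMField L] {v : HeightOneSpectrum (𝓞 ↥(maximalRealSubfield L))}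
  (w : UnitaryGroup.PlacesOver L v) (hw : IsCMField.complexConj L • w.1 = w.1)

/-- **CORNER UNIPOTENTS OF `K`**: for a SKEW `t ∈ 𝒪_w` (`σ_w t = −t`, `|t| ≤ 1`) there is `x ∈ K = U(Φ₃)(𝒪_v)` with `wMatrix x = n(t)` — `n(t) ∈ U(σ_w, Φ₃)` (★
`mem_unitaryGroupOfForm_iff_of_coe_eq_cornerUnipotent`), pulled back along `ψ = localNonsplitEquiv` (★ `placeForm_antidiagThree_eq_over`), and `wMatrix x − 1 = t·E₀₂` is
integral, so `x ∈ K` (★ `mem_cmLocalIntegralLevel_of_inLevel` at `M = 0`). [cite: Rogawski1990, §1.10 p. 9, §4.9 p. 54] -/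
theorem exists_mem_wMatrix_eq_cornerUnipotent {ϖ : w.1.adicCompletion L} (hϖ : Valued.v ϖ = WithZero.exp (-1 : ℤ)) {t : w.1.adicCompletion L}
    (hσt : galAdicCompletionMap (L := L) (IsCMField.complexConj L) hw t = -t) (hvt : Valued.v t ≤ 1) :
    ∃ x : ((UnitaryGroup.cmDatum L 3 (Matrix.of fun i j : Fin 3 => if i.val + j.val + 1 = 3 then (1 : L) else 0)).Local v),
      x ∈ cmLocalIntegralLevel L 3 (Matrix.of fun i j : Fin 3 => if i.val + j.val + 1 = 3 then (1 : L) else 0) v ∧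
      wMatrix L w hw x = !![1, 0, t; 0, 1, 0; 0, 0, 1] := by
  obtain ⟨hϖ0, -, hϖ1⟩ := uniformizer_facts L w hϖ
  obtain ⟨n, hn, -⟩ := exists_units_coe_eq_cornerUnipotent t
  have hmem : n ∈ unitaryGroupOfForm (galAdicCompletionMap (L := L) (IsCMField.complexConj L) hw) ((StdForm.antidiagonal 3).over (w.1.adicCompletion L)) :=
    (mem_unitaryGroupOfForm_iff_of_coe_eq_cornerUnipotent (galAdicCompletionMap (L := L) (IsCMField.complexConj L) hw) hn).2 (by rw [hσt, neg_add_cancel])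
  have hmem' : n ∈ unitaryGroupOfForm (galAdicCompletionMap (L := L) (IsCMField.complexConj L) hw) (placeForm (Matrix.of fun i j : Fin 3 => if i.val + j.val + 1 = 3 then (1 : L) else 0) w.1) := by
    rw [placeForm_antidiagThree_eq_over L w]; exact hmem
  set x : ((UnitaryGroup.cmDatum L 3 (Matrix.of fun i j : Fin 3 => if i.val + j.val + 1 = 3 then (1 : L) else 0)).Local v) :=
    (localNonsplitEquiv (IsCMField.complexConj L) (Matrix.of fun i j : Fin 3 => if i.val + j.val + 1 = 3 then (1 : L) else 0) (IsCMField.complexConj_ne_one L) w hw).symm ⟨n, hmem'⟩ with hx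
  have hψx : ((localNonsplitEquiv (IsCMField.complexConj L) (Matrix.of fun i j : Fin 3 => if i.val + j.val + 1 = 3 then (1 : L) else 0) (IsCMField.complexConj_ne_one L) w hw x :
      ↥(unitaryGroupOfForm (galAdicCompletionMap (L := L) (IsCMField.complexConj L) hw) (placeForm (Matrix.of fun i j : Fin 3 => if i.val + j.val + 1 = 3 then (1 : L) else 0) w.1))) :
        GL (Fin 3) (w.1.adicCompletion L)) = n := by
    rw [hx, ContinuousMulEquiv.apply_symm_apply]
  have hwx : wMatrix L w hw x = !![1, 0, t; 0, 1, 0; 0, 0, 1] := by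
    unfold wMatrix
    rw [hψx]; exact hn
  refine ⟨x, ?_, hwx⟩
  refine mem_cmLocalIntegralLevel_of_inLevel L w hw hϖ0 hϖ1 0 x fun a b => ?_
  rw [hψx, hn, pow_zero, inv_one, one_mul, ← Matrix.sub_apply, cornerUnipotent_sub_one_apply]
  split_ifs
  · exact hvt
  · rw [map_zero]; exact zero_le

/-! ## §2  The class-`+` diagonal witness -/

/-- **THE CLASS-`+` WITNESS (T3, `ℓ = 1`).**  At a ramified `σ`-stable place `w ∣ v` with uniformiser `ϖ`, every conjugacy class `c` of `U(Φ₃)(L⁺_v)` whose representative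
is a class-`+` transvection (`X ≠ 0`, `X² = 0`, `NormClassPlus σ_w ϖ dOfPlace X`, `X = wMatrix (out c) − 1`) MEETS THE SUPPORT SET OF `f_{T+}`: the corner unipotent
`x₊ = ψ⁻¹ n(t₊) ∈ K` (`wMatrix x₊ − 1 = xPlus σ_w ϖ dOfPlace`: shell depth `ℓ₀ = dOfPlace % 2` at level `mstarFn`, `LabelPlus` by definition) lies in `c` (★ T1
`isConj_of_normClassPlus`).  LH4-p02's interface head; set = the set-builder of ★ `pieceTransvPlus` verbatim. [cite: Rogawski1990, §3.9 p. 32, §4.9 p. 54]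
[cite: LabesseLanglands1979, §2] -/
theorem exists_mem_supportTransvPlus_mk_eq (he : v.asIdeal.ramificationIdx' w.1.asIdeal ≠ 1)
    (ϖ : w.1.adicCompletion L) (hϖ : Valued.v ϖ = WithZero.exp (-1 : ℤ))
    (c : ConjClasses ((UnitaryGroup.cmDatum L 3 (Matrix.of fun i j : Fin 3 => if i.val + j.val + 1 = 3 then (1 : L) else 0)).Local v))
    (h0 : wMatrix L w hw (Quotient.out c) - 1 ≠ 0)
    (hsq : (wMatrix L w hw (Quotient.out c) - 1) * (wMatrix L w hw (Quotient.out c) - 1) = 0)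
    (hN : NormClassPlus (galAdicCompletionMap (L := L) (IsCMField.complexConj L) hw) ϖ (dOfPlace L v w) (wMatrix L w hw (Quotient.out c) - 1)) :
    ∃ x : ((UnitaryGroup.cmDatum L 3 (Matrix.of fun i j : Fin 3 => if i.val + j.val + 1 = 3 then (1 : L) else 0)).Local v),
      x ∈ {u : ((UnitaryGroup.cmDatum L 3 (Matrix.of fun i j : Fin 3 => if i.val + j.val + 1 = 3 then (1 : L) else 0)).Local v) |
        u ∈ cmLocalIntegralLevel L 3 (Matrix.of fun i j : Fin 3 => if i.val + j.val + 1 = 3 then (1 : L) else 0) v ∧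
        NearTransvShell ϖ (dOfPlace L v w % 2) (mstarFn L v w) (wMatrix L w hw u - 1) ∧
        LabelPlus (galAdicCompletionMap (L := L) (IsCMField.complexConj L) hw) ϖ (dOfPlace L v w) (mstarFn L v w) (wMatrix L w hw u - 1)} ∧
      ConjClasses.mk x = c := by
  obtain ⟨d, t₂, hD⟩ := exists_isRamifiedQuadraticDatum_of_placesOver L w hw he ϖ hϖ
  have hdd : dOfPlace L v w = d := dOfPlace_eq_of_isRamifiedQuadraticDatum L w hw he hD
  obtain ⟨hσσ, hvσ, -, -, hdv, -, -⟩ := hD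
  -- the reference skew scalar `t₊`: skew, `|t₊| = exp(−ℓ₀) ≤ 1`, non-zero
  have hvtp : Valued.v ((ϖ - galAdicCompletionMap (L := L) (IsCMField.complexConj L) hw ϖ) *
      ((ϖ * galAdicCompletionMap (L := L) (IsCMField.complexConj L) hw ϖ) ^ ((d - d % 2) / 2))⁻¹) = exp (-((d % 2 : ℕ) : ℤ)) := v_refSkewScalar hvσ hϖ hdv
  have htp0 : (ϖ - galAdicCompletionMap (L := L) (IsCMField.complexConj L) hw ϖ) *
      ((ϖ * galAdicCompletionMap (L := L) (IsCMField.complexConj L) hw ϖ) ^ ((d - d % 2) / 2))⁻¹ ≠ 0 := refSkewScalar_ne_zero hvσ hϖ hdv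
  have hvtp1 : Valued.v ((ϖ - galAdicCompletionMap (L := L) (IsCMField.complexConj L) hw ϖ) *
      ((ϖ * galAdicCompletionMap (L := L) (IsCMField.complexConj L) hw ϖ) ^ ((d - d % 2) / 2))⁻¹) ≤ 1 := by
    rw [hvtp, ← exp_zero, exp_le_exp]; omega
  -- the corner unipotent `x₊ ∈ K`, `wMatrix x₊ − 1 = xPlus`
  obtain ⟨x, hxK, hwx⟩ := exists_mem_wMatrix_eq_cornerUnipotent L w hw hϖ (map_refSkewScalar_eq_neg hσσ _) hvtp1
  have hX : wMatrix L w hw x - 1 = xPlus (galAdicCompletionMap (L := L) (IsCMField.complexConj L) hw) ϖ d := by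
    rw [hwx, cornerUnipotent_sub_one, xPlus_eq]
  -- `x₊` is a class-`+` transvection: `X ≠ 0`, `X² = 0`, `NormClassPlus` (witnesses `y = y′ = e₂`, `z = 1`)
  have hX0 : wMatrix L w hw x - 1 ≠ 0 := by
    rw [hX]
    intro h
    have h02 := congrFun (congrFun h 0) 2
    rw [xPlus_apply, if_pos ⟨rfl, rfl⟩, Matrix.zero_apply] at h02
    exact htp0 h02
  have hXsq : (wMatrix L w hw x - 1) * (wMatrix L w hw x - 1) = 0 := by rw [hX]; exact xPlus_mul_xPlus _ ϖ d
  have hXN : NormClassPlus (galAdicCompletionMap (L := L) (IsCMField.complexConj L) hw) ϖ (dOfPlace L v w) (wMatrix L w hw x - 1) := by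
    rw [hdd, hX]
    refine ⟨Pi.single 2 1, Pi.single 2 1, 1, ?_, ?_⟩
    · rw [pairing_xPlus_mulVec, Pi.single_eq_same, map_one, mul_one, mul_one]
      exact htp0
    · rw [map_one, mul_one, mul_one]
  -- hence `out c ~ x₊` (the classes of the `n(t)` are the norm classes)
  have hconj : IsConj (Quotient.out c) x := isConj_of_normClassPlus L w hw ϖ (dOfPlace L v w) h0 hsq hN hX0 hXsq hXN
  refine ⟨x, ⟨hxK, ?_, ?_⟩, ?_⟩
  · rw [hX, hdd]; exact nearTransvShell_xPlus hvσ hϖ hdv _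
  · rw [hX, hdd]; exact labelPlus_xPlus _ ϖ d _
  · rw [← Quotient.out_eq c, ConjClasses.quotient_mk_eq_mk, ConjClasses.mk_eq_mk_iff_isConj]
    exact hconj.symm

end CM

end Summit.HodgeConjecture.HodgeConjecture.Cruxes.H413.F0P3cDyRamTableDiagWitnessTransvPlus

end
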